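import Summits.QuantumFields.BalabanUV.Beta.FP.WordPointwiseShape
import Summits.QuantumFields.BalabanUV.Beta.FP.LegPairingBounds

/-!
# `BalabanUV.Beta.FP.WordPointwiseShapeHk` — road «FP» for binder row D1, ROW KER-γ (α2) (owner memo `KER-GAMMA-ALPHA2.md` §3∕§5, R-FP-34∕35∕36), sequel of
# `FP/WordPointwiseShape`: THE CLOSED-FORM r-WEIGHTED MASSES (bi-localised jets, windowed jets) AND THE (hk) CURRENCY OF `FineSplitJunctionTwoLeg` ON `ℤ⁴`
# — the word families `s s′ ↦ biBubble A (V s) B (W s′)` ∕ `tadpole A (W s s′)` obey VERBATIM the pointwise MIX shape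
# `|G s s′| ≤ M₁ s·M₂ s′·E₀·e^{−(2δ∕N)‖s′−s‖∞}` of `coarse_secondMoment_abs_twoLeg` ∕ `rem_window_of_twoLeg` ∕ `rem_of_twoLeg`

HONEST DEPENDENCY (page 1, mandatory): continuum YM on T⁴ ⇐ BetaPertH ∧ nine spine estimates (0/9 proved); BetaPertH ⇐ (D1) ∧ (D4) ∧
CAP+tail; G-an2-4 gates asym, D1 and NE2/3/4.  HONEST FRAMING (cell contract, verbatim): «discharging `BetaPertH` makes Bałaban's UV
stability UNCONDITIONAL — a real constructive-QFT result; it is NOT the continuum limit and NOT the Clay problem.»  THIS MODULE is elementary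
[folklore] bookkeeping BY NAME over `FP/WordPointwiseShape` (`abs_biBubble_le_wmass`, `abs_tadpole_le_wmass`, `mass_nonneg_of_letter`),
`ExpKernelCalculus` (`BiLoc`, `Zl`, `summable_exp_shift'`, `tsum_exp_shift'`, `l1_sub_symm`), `DyadicShell` (`Pt`, `supNorm`) and `LegPairingBounds.supNorm_le_l1`.  No `def`, no
`def … : Prop`, nothing cited, nothing of the manuscripts under audit asserted, 0 sorry.  NOT the instance at the road's leg∕stencils∕bi-tables (α2-a PART 2
proper), NOT the mass letters (M₁)(M₂) of the two-leg core, NOT (LEDGER), NOT hsplit, NOT (ASYMP), NOT D1; 0∕4 row-D1 binders; NOT BetaPertH, NOT continuum,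
NOT Clay.

ABSOLUTE RULE (cell charter, verbatim): «No internally-minted statement may enter as a cited fact. Every hypothesis is either kernel-proved in this
package or a verbatim quotation of a PUBLISHED theorem with page reference. The manuscript(s) under audit are NOT citable for their own disputed
steps — they are the thing under adjudication; programme-internal (2001/route/tribunal) claims are never citable.»

CONTENT ([folklore]).
* §1 CLOSED-FORM MASSES: **`wmass_le_of_biLoc`** (`BiLoc K p p′ C δ`, `r < δ` ⟹ every finite-window r-weighted sum `≤ (card F)²·C·Zl(δ−r)²` — the
  uniform-letter jets: the `Ḣ`∕`Ḧ`-type blocks, the R-words of (G1)(G2)), **`wmass_le_of_support`** (support in the radius-`R` `|·|₁`-balls at the anchors +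
  plain ℓ¹ letter `L`, `0 ≤ r` ⟹ `≤ e^{rR}·e^{rR}·L` — the block-averaging `Q̇`∕`Q̈`-type blocks: radius `R·N` at `r = δ∕N` is the engines' `e^{2Rδ}`).
* §2 THE (hk) CURRENCY (`D = 4`, `Pt`, `‖·‖∞ ≤ |·|₁`, leg rate `r = δ₀∕N`): **`hk_biBubble`** (`|biBubble A (V s) B (W s′)| ≤
  M₁ s·M₂ s′·(C_A·C_B)·e^{−(2δ₀∕N)‖s′−s‖∞}`), **`hk_tadpole`** (`|tadpole A (W s s′)| ≤ M₁ s·M₂ s′·C_A·e^{−(δ₀∕N)‖s′−s‖∞}`, ONE leg), `hk_tadpole'`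
  (the same in the two-leg core's verbatim spelling `−(2·(δ₀∕2)∕N)`).
Provenance: D1 formalisation swarm LEAF PROVER 01, unit `b2b-balaban-beta-d1-formalise-leaf-01` gen 12, 2026-08-21, road FP row KER-γ (α2); «not in print; our bookkeeping».
-/

noncomputable section

namespace Summit.QuantumFields.BalabanUV.Beta.FP.WordPointwiseShapeHk

open Finset
open scoped BigOperators
open Literature.MathematicalPhysics.QuantumFieldTheory.Balaban1983to89
open Literature.MathematicalPhysics.QuantumFieldTheory.Balaban1983to89.Beta
open B12Sec2to5 (l1 l1_nonneg)
open ExpKernelCalculus (Site MKer Decays BiLoc tadpole Zl Zl_nonneg l1_sub_symm summable_exp_shift' tsum_exp_shift')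
open Summit.QuantumFields.BalabanUV.Beta.D1BFx.PackedKernelSplit (biBubble)
open Summit.QuantumFields.BalabanUV.Beta.FP.WordPointwiseShape (mass_nonneg_of_letter abs_tadpole_le_wmass abs_biBubble_le_wmass)
open DyadicShell (Pt supNorm)
open Summit.QuantumFields.BalabanUV.Beta.FP.LegPairingBounds (supNorm_le_l1)

variable {D : ℕ} {F : Type*} [Fintype F]


/-! ## §1 Closed-form masses -/

section Masses

variable {K : MKer D F} {p p' : Site D}

/-- **THE r-WEIGHTED MASS OF A BI-LOCALISED JET** [folklore]: `BiLoc K p p′ C δ` and `r < δ` (any real `r`) ⟹ every finite-window weighted sum is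
`≤ (card F)²·C·Zl(δ−r)²` — so for uniform-letter jets the words of §3 are one `exact` (the `Ḣ`∕`Ḧ`-type blocks; the R-words of (G1)(G2)). -/
theorem wmass_le_of_biLoc {C δ r : ℝ} (hK : BiLoc K p p' C δ) (hrδ : r < δ) (T : Finset (Site D × Site D)) :
    ∑ yz ∈ T, ∑ f, ∑ g, Real.exp (r * l1 (yz.1 - p)) * Real.exp (r * l1 (yz.2 - p')) * |K yz.1 yz.2 f g|
      ≤ (Fintype.card F : ℝ) ^ 2 * C * Zl D (δ - r) ^ 2 := by
  classical
  rcases isEmpty_or_nonempty F with hE | ⟨⟨a₀⟩⟩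
  · simp
  have hC : 0 ≤ C := hK.nonneg a₀
  have hδr : 0 < δ - r := by linarith
  have hterm : ∀ (y z : Site D) (f g : F), Real.exp (r * l1 (y - p)) * Real.exp (r * l1 (z - p')) * |K y z f g|
      ≤ C * (Real.exp (-(δ - r) * l1 (y - p)) * Real.exp (-(δ - r) * l1 (z - p'))) := by
    intro y z f g
    have e1 : Real.exp (r * l1 (y - p)) * Real.exp (-δ * l1 (y - p)) = Real.exp (-(δ - r) * l1 (y - p)) := by
      rw [← Real.exp_add]; ring_nf
    have e2 : Real.exp (r * l1 (z - p')) * Real.exp (-δ * l1 (z - p')) = Real.exp (-(δ - r) * l1 (z - p')) := by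
      rw [← Real.exp_add]; ring_nf
    calc Real.exp (r * l1 (y - p)) * Real.exp (r * l1 (z - p')) * |K y z f g|
        ≤ Real.exp (r * l1 (y - p)) * Real.exp (r * l1 (z - p')) * (C * Real.exp (-δ * (l1 (y - p) + l1 (z - p')))) :=
          mul_le_mul_of_nonneg_left (hK y z f g) (by positivity)
      _ = C * ((Real.exp (r * l1 (y - p)) * Real.exp (-δ * l1 (y - p))) * (Real.exp (r * l1 (z - p')) * Real.exp (-δ * l1 (z - p')))) := by
          rw [show -δ * (l1 (y - p) + l1 (z - p')) = -δ * l1 (y - p) + -δ * l1 (z - p') by ring, Real.exp_add]; ring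
      _ = _ := by rw [e1, e2]
  have hsy := summable_exp_shift' (D := D) hδr p
  have hsz := summable_exp_shift' (D := D) hδr p'
  calc ∑ yz ∈ T, ∑ f, ∑ g, Real.exp (r * l1 (yz.1 - p)) * Real.exp (r * l1 (yz.2 - p')) * |K yz.1 yz.2 f g|
      ≤ ∑ yz ∈ T, ∑ _f : F, ∑ _g : F, C * (Real.exp (-(δ - r) * l1 (yz.1 - p)) * Real.exp (-(δ - r) * l1 (yz.2 - p'))) :=
        Finset.sum_le_sum fun yz _ => Finset.sum_le_sum fun f _ => Finset.sum_le_sum fun g _ => hterm _ _ f g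
    _ = ∑ yz ∈ T, (Fintype.card F : ℝ) ^ 2 * C * (Real.exp (-(δ - r) * l1 (yz.1 - p)) * Real.exp (-(δ - r) * l1 (yz.2 - p'))) := by
        refine Finset.sum_congr rfl fun yz _ => ?_
        simp only [Finset.sum_const, Finset.card_univ, nsmul_eq_mul]
        ring
    _ ≤ ∑ yz ∈ T.image Prod.fst ×ˢ T.image Prod.snd,
          (Fintype.card F : ℝ) ^ 2 * C * (Real.exp (-(δ - r) * l1 (yz.1 - p)) * Real.exp (-(δ - r) * l1 (yz.2 - p'))) :=
        Finset.sum_le_sum_of_subset_of_nonneg Finset.subset_product fun _ _ _ => by positivity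
    _ = (Fintype.card F : ℝ) ^ 2 * C * ((∑ y ∈ T.image Prod.fst, Real.exp (-(δ - r) * l1 (y - p))) *
          (∑ z ∈ T.image Prod.snd, Real.exp (-(δ - r) * l1 (z - p')))) := by
        rw [Finset.sum_product, Finset.sum_mul_sum, Finset.mul_sum]
        exact Finset.sum_congr rfl fun y _ => by rw [Finset.mul_sum]
    _ ≤ (Fintype.card F : ℝ) ^ 2 * C * (Zl D (δ - r) * Zl D (δ - r)) := by
        apply mul_le_mul_of_nonneg_left _ (by positivity)
        have h1 : ∑ y ∈ T.image Prod.fst, Real.exp (-(δ - r) * l1 (y - p)) ≤ Zl D (δ - r) := by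
          rw [← tsum_exp_shift' (c := δ - r) p]
          exact hsy.sum_le_tsum _ fun _ _ => (Real.exp_pos _).le
        have h2 : ∑ z ∈ T.image Prod.snd, Real.exp (-(δ - r) * l1 (z - p')) ≤ Zl D (δ - r) := by
          rw [← tsum_exp_shift' (c := δ - r) p']
          exact hsz.sum_le_tsum _ fun _ _ => (Real.exp_pos _).le
        exact mul_le_mul h1 h2 (Finset.sum_nonneg fun _ _ => (Real.exp_pos _).le) (Zl_nonneg hδr)
    _ = _ := by ring

/-- **THE r-WEIGHTED MASS OF A WINDOWED JET** [folklore]: if `K y z f g ≠ 0` only for `|y−p|₁ ≤ R`, `|z−p′|₁ ≤ R` (`0 ≤ r`) and the plain ℓ¹ letter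
`∀ T, Σ_{(y,z)∈T} Σ_{f,g} |K y z f g| ≤ L` holds, every finite-window weighted sum is `≤ e^{rR}·e^{rR}·L` (the block-averaging `Q̇`∕`Q̈`-type blocks:
radius `R·N` at `r = δ∕N` gives the engines' `e^{2Rδ}`). -/
theorem wmass_le_of_support {r R L : ℝ} (hr : 0 ≤ r)
    (hsupp : ∀ (y z : Site D) (f g : F), K y z f g ≠ 0 → l1 (y - p) ≤ R ∧ l1 (z - p') ≤ R)
    (hL : ∀ T : Finset (Site D × Site D), ∑ yz ∈ T, ∑ f, ∑ g, |K yz.1 yz.2 f g| ≤ L) (T : Finset (Site D × Site D)) :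
    ∑ yz ∈ T, ∑ f, ∑ g, Real.exp (r * l1 (yz.1 - p)) * Real.exp (r * l1 (yz.2 - p')) * |K yz.1 yz.2 f g|
      ≤ Real.exp (r * R) * Real.exp (r * R) * L := by
  have hterm : ∀ (y z : Site D) (f g : F), Real.exp (r * l1 (y - p)) * Real.exp (r * l1 (z - p')) * |K y z f g|
      ≤ Real.exp (r * R) * Real.exp (r * R) * |K y z f g| := by
    intro y z f g
    by_cases h0 : K y z f g = 0
    · simp [h0]
    · obtain ⟨h1, h2⟩ := hsupp y z f g h0
      refine mul_le_mul_of_nonneg_right ?_ (abs_nonneg _)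
      exact mul_le_mul (Real.exp_le_exp.mpr (by nlinarith)) (Real.exp_le_exp.mpr (by nlinarith))
        (Real.exp_pos _).le (Real.exp_pos _).le
  calc ∑ yz ∈ T, ∑ f, ∑ g, Real.exp (r * l1 (yz.1 - p)) * Real.exp (r * l1 (yz.2 - p')) * |K yz.1 yz.2 f g|
      ≤ ∑ yz ∈ T, ∑ f, ∑ g, Real.exp (r * R) * Real.exp (r * R) * |K yz.1 yz.2 f g| :=
        Finset.sum_le_sum fun yz _ => Finset.sum_le_sum fun f _ => Finset.sum_le_sum fun g _ => hterm _ _ f g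
    _ = Real.exp (r * R) * Real.exp (r * R) * ∑ yz ∈ T, ∑ f, ∑ g, |K yz.1 yz.2 f g| := by
        simp_rw [Finset.mul_sum]
    _ ≤ _ := mul_le_mul_of_nonneg_left (hL T) (by positivity)

end Masses

/-! ## §2 The (hk) currency of `FineSplitJunctionTwoLeg` (`D = 4`) -/

section HK

variable [Nonempty F]

/-- **(hk) FOR A FAMILY OF TWO-LEG BUBBLE WORDS** [folklore] (`D = 4`, leg rate `r = δ₀∕N`, `0 ≤ δ₀`): jets `V s` anchored `(s, s)` with r-weighted
masses `≤ M₁ s`, `W s′` anchored `(s′, s′)` with masses `≤ M₂ s′`, legs `Decays A C_A (δ₀∕N)`, `Decays B C_B (δ₀∕N)` ⟹ for all `s s′`,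
`|biBubble A (V s) B (W s′)| ≤ M₁ s·M₂ s′·(C_A·C_B)·e^{−(2δ₀∕N)‖s′−s‖∞}` — VERBATIM the pointwise MIX shape (hk) of `coarse_secondMoment_abs_twoLeg`
(`E₀ := C_A·C_B`, `δ := δ₀`). -/
theorem hk_biBubble {A B : MKer 4 F} {V W : Pt → MKer 4 F} {C_A C_B δ₀ : ℝ} {N : ℕ} {M₁ M₂ : Pt → ℝ} (hδ₀ : 0 ≤ δ₀)
    (hA : Decays A C_A (δ₀ / N)) (hB : Decays B C_B (δ₀ / N))
    (hV : ∀ (s : Pt) (T : Finset (Site 4 × Site 4)), ∑ yz ∈ T, ∑ f, ∑ g,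
      Real.exp (δ₀ / N * l1 (yz.1 - s)) * Real.exp (δ₀ / N * l1 (yz.2 - s)) * |V s yz.1 yz.2 f g| ≤ M₁ s)
    (hW : ∀ (s' : Pt) (T : Finset (Site 4 × Site 4)), ∑ yz ∈ T, ∑ f, ∑ g,
      Real.exp (δ₀ / N * l1 (yz.1 - s')) * Real.exp (δ₀ / N * l1 (yz.2 - s')) * |W s' yz.1 yz.2 f g| ≤ M₂ s')
    (s s' : Pt) :
    |biBubble A (V s) B (W s')| ≤ M₁ s * M₂ s' * (C_A * C_B) * Real.exp (-(2 * δ₀ / N) * (supNorm (s' - s) : ℝ)) := by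
  obtain ⟨a₀⟩ := ‹Nonempty F›
  have hr : 0 ≤ δ₀ / N := by positivity
  have hCA : 0 ≤ C_A := hA.nonneg a₀
  have hCB : 0 ≤ C_B := hB.nonneg a₀
  have hM₁ : 0 ≤ M₁ s := mass_nonneg_of_letter (hV s)
  have hM₂ : 0 ≤ M₂ s' := mass_nonneg_of_letter (hW s')
  have h := abs_biBubble_le_wmass hA hB hr (hV s) (hW s')
  have hl : (supNorm (s' - s) : ℝ) ≤ l1 (s' - s) := supNorm_le_l1 _
  have e1 : l1 (s - s') = l1 (s' - s) := l1_sub_symm s s'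
  have hexp : Real.exp (-(δ₀ / N) * l1 (s - s')) * Real.exp (-(δ₀ / N) * l1 (s' - s))
      ≤ Real.exp (-(2 * δ₀ / N) * (supNorm (s' - s) : ℝ)) := by
    rw [e1, ← Real.exp_add]
    apply Real.exp_le_exp.mpr
    have h2 : 0 ≤ δ₀ / N * (l1 (s' - s) - (supNorm (s' - s) : ℝ)) := mul_nonneg hr (sub_nonneg.mpr hl)
    have e : -(δ₀ / N) * l1 (s' - s) + -(δ₀ / N) * l1 (s' - s)
        = -(2 * δ₀ / N) * (supNorm (s' - s) : ℝ) - 2 * (δ₀ / N * (l1 (s' - s) - (supNorm (s' - s) : ℝ))) := by ring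
    rw [e]
    linarith
  calc |biBubble A (V s) B (W s')|
      ≤ C_A * C_B * M₁ s * M₂ s' * (Real.exp (-(δ₀ / N) * l1 (s - s')) * Real.exp (-(δ₀ / N) * l1 (s' - s))) := h
    _ ≤ C_A * C_B * M₁ s * M₂ s' * Real.exp (-(2 * δ₀ / N) * (supNorm (s' - s) : ℝ)) :=
        mul_le_mul_of_nonneg_left hexp (mul_nonneg (mul_nonneg (mul_nonneg hCA hCB) hM₁) hM₂)
    _ = _ := by ring

/-- **(hk) FOR A FAMILY OF TADPOLE WORDS** [folklore] (`D = 4`, leg rate `δ₀∕N`, `0 ≤ δ₀`): bi-tables `W s s′` anchored `(s, s′)` with JOINT r-weighted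
masses `≤ M₁ s·M₂ s′` (displayed product form), leg `Decays A C_A (δ₀∕N)` ⟹ `|tadpole A (W s s′)| ≤ M₁ s·M₂ s′·C_A·e^{−(δ₀∕N)‖s′−s‖∞}` — ONE leg, so the
(hk) rate is `δ₀∕2` (see `hk_tadpole'`). -/
theorem hk_tadpole {A : MKer 4 F} {W : Pt → Pt → MKer 4 F} {C_A δ₀ : ℝ} {N : ℕ} {M₁ M₂ : Pt → ℝ} (hδ₀ : 0 ≤ δ₀)
    (hA : Decays A C_A (δ₀ / N))
    (hW : ∀ (s s' : Pt) (T : Finset (Site 4 × Site 4)), ∑ yz ∈ T, ∑ f, ∑ g,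
      Real.exp (δ₀ / N * l1 (yz.1 - s)) * Real.exp (δ₀ / N * l1 (yz.2 - s')) * |W s s' yz.1 yz.2 f g| ≤ M₁ s * M₂ s')
    (s s' : Pt) :
    |tadpole A (W s s')| ≤ M₁ s * M₂ s' * C_A * Real.exp (-(δ₀ / N) * (supNorm (s' - s) : ℝ)) := by
  obtain ⟨a₀⟩ := ‹Nonempty F›
  have hr : 0 ≤ δ₀ / N := by positivity
  have hCA : 0 ≤ C_A := hA.nonneg a₀
  have hM : 0 ≤ M₁ s * M₂ s' := mass_nonneg_of_letter (hW s s')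
  have h := abs_tadpole_le_wmass hA hr (hW s s')
  have hl : (supNorm (s' - s) : ℝ) ≤ l1 (s' - s) := supNorm_le_l1 _
  have hexp : Real.exp (-(δ₀ / N) * l1 (s' - s)) ≤ Real.exp (-(δ₀ / N) * (supNorm (s' - s) : ℝ)) :=
    Real.exp_le_exp.mpr (by nlinarith)
  calc |tadpole A (W s s')| ≤ C_A * (M₁ s * M₂ s') * Real.exp (-(δ₀ / N) * l1 (s' - s)) := h
    _ ≤ C_A * (M₁ s * M₂ s') * Real.exp (-(δ₀ / N) * (supNorm (s' - s) : ℝ)) :=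
        mul_le_mul_of_nonneg_left hexp (mul_nonneg hCA hM)
    _ = _ := by ring

/-- [folklore] `hk_tadpole` in the VERBATIM spelling of `coarse_secondMoment_abs_twoLeg`'s (hk) with `δ := δ₀∕2`, `E₀ := C_A`:
`|tadpole A (W s s′)| ≤ M₁ s·M₂ s′·C_A·e^{−(2·(δ₀∕2)∕N)‖s′−s‖∞}`. -/
theorem hk_tadpole' {A : MKer 4 F} {W : Pt → Pt → MKer 4 F} {C_A δ₀ : ℝ} {N : ℕ} {M₁ M₂ : Pt → ℝ} (hδ₀ : 0 ≤ δ₀)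
    (hA : Decays A C_A (δ₀ / N))
    (hW : ∀ (s s' : Pt) (T : Finset (Site 4 × Site 4)), ∑ yz ∈ T, ∑ f, ∑ g,
      Real.exp (δ₀ / N * l1 (yz.1 - s)) * Real.exp (δ₀ / N * l1 (yz.2 - s')) * |W s s' yz.1 yz.2 f g| ≤ M₁ s * M₂ s')
    (s s' : Pt) :
    |tadpole A (W s s')| ≤ M₁ s * M₂ s' * C_A * Real.exp (-(2 * (δ₀ / 2) / N) * (supNorm (s' - s) : ℝ)) := by
  have e : (2 * (δ₀ / 2) / N : ℝ) = δ₀ / N := by ring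
  rw [e]
  exact hk_tadpole hδ₀ hA hW s s'

end HK

end Summit.QuantumFields.BalabanUV.Beta.FP.WordPointwiseShapeHk

end
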